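import Literature.MathematicalPhysics.QuantumLattice.FermionOperatorsProofs
import HarnessLib

/-!
# Discharge of `etaRaise_commute_spin`: Yang's `η†` commutes with the spin operators

Trunk T-QLATTICE, family `hubbard`. Sibling proof file of
`Literature/MathematicalPhysics/QuantumLattice/FermionOperators.lean`, built on the CAR algebra of
`FermionOperatorsProofs.lean` (`hop_pair_commutator`, `number_pair_commutator`,
`commutator_etaRaise`, `creation_mul_self`); no statement is introduced or changed.

Proved here: for every sign `ε : Λ → ℤˣ`, Yang's pair creator
`η†_ε = Σ_z ε_z c†_{z↑} c†_{z↓}` commutes with `S⁺ = Σ_x c†_{x↑} c_{x↓}` and with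
`S^z = ½ Σ_x (n_{x↑} - n_{x↓})` — the statement `Literature.MathematicalPhysics.QuantumLattice.etaRaise_commute_spin`, discharged
as `etaRaise_commute_spin_holds`. This is the mutual commutativity of the pseudospin `J`
(`η† = J_x + iJ_y`) and the spin `J'` (`ζ† = J'_x + iJ'_y`, `J'_z = ½ Σ (a†a - b†b)`) of
Yang–Zhang, *SO₄ symmetry in a Hubbard model*, Mod. Phys. Lett. B **4** (1990) 759, Theorem 2
(p. 760: "all 3 components of J commute with all 3 components of J'"), i.e. `[S^α, η^β] = 0`,
Essler–Frahm–Göhmann–Klümper–Korepin (2005) §2.2.5, eq. (2.85). The proof is the termwise one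
printed by Essler et al. (loc. cit., after (2.85)): each `c†_{x↑} c_{x↓}` commutes with each
`c†_{z↑} c†_{z↓}` (for `x = z` both products contain `(c†_{z↑})² = 0`), and
`[n_{x↑} - n_{x↓}, c†_{z↑} c†_{z↓}] = (δ_{xz} - δ_{xz}) c†_{z↑} c†_{z↓} = 0`. The signs `ε_z` and
the lattice play no role, so the result holds for every `ε` and every finite `Λ`, as stated.

## Sources

C. N. Yang, S. C. Zhang, *SO₄ symmetry in a Hubbard model*, Mod. Phys. Lett. B **4** (1990)
759–766, Theorem 2 (reprinted in A. Montorsi (ed.), *The Hubbard Model*, World Scientific 1992);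
F. H. L. Essler, H. Frahm, F. Göhmann, A. Klümper, V. E. Korepin, *The One-Dimensional Hubbard
Model* (CUP 2005), §2.2.5, eqs. (2.79)–(2.85).
-/

namespace Literature.MathematicalPhysics.QuantumLattice

open Matrix Finset HubbardWave0

section Hubbard

variable {Λ : Type*} [LinearOrder Λ] [Fintype Λ]

/-- `[S⁺, c†_{z↑} c†_{z↓}] = 0`: by `hop_pair_commutator`,
`[c†_{x↑} c_{x↓}, c†_{z↑} c†_{z↓}] = δ_{x↓,z↑} c†_{x↑} c†_{z↓} - δ_{x↓,z↓} c†_{x↑} c†_{z↑}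
= -δ_{xz} (c†_{z↑})² = 0`. Essler et al. (2005) §2.2.5, proof of eq. (2.85).
[cite: EsslerEtAl2005, §2.2.5 eq. (2.85)] -/
theorem spinPlus_commutator_pairCreation (z : Λ) :
    spinPlus * (creation (orb z 0) * creation (orb z 1)) -
        creation (orb z 0) * creation (orb z 1) * spinPlus = 0 := by
  simp only [spinPlus, sum_mul, mul_sum, ← sum_sub_distrib, hop_pair_commutator]
  refine sum_eq_zero fun x _ => ?_
  rw [if_neg (show orb x 1 ≠ orb z 0 from fun h => absurd (orb_eq_orb_iff.1 h).2 (by decide)),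
    zero_sub, neg_eq_zero]
  split_ifs with h
  · rw [(orb_eq_orb_iff.1 h).1, creation_mul_self]
  · rfl

/-- `[S^z, c†_{z↑} c†_{z↓}] = 0`: by `number_pair_commutator`,
`[n_{xσ}, c†_{z↑} c†_{z↓}] = (δ_{xσ,z↑} + δ_{xσ,z↓}) c†_{z↑} c†_{z↓}`, so the `↑` and `↓`
contributions to `[Σ_x (n_{x↑} - n_{x↓}), c†_{z↑} c†_{z↓}]` cancel (a pair carries no `S^z`).
Essler et al. (2005) §2.2.5, proof of eq. (2.85). [cite: EsslerEtAl2005, §2.2.5 eq. (2.85)] -/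
theorem spinZ_commutator_pairCreation (z : Λ) :
    spinZ * (creation (orb z 0) * creation (orb z 1)) -
        creation (orb z 0) * creation (orb z 1) * spinZ = 0 := by
  simp only [spinZ, smul_mul_assoc, mul_smul_comm, ← smul_sub, sum_mul, mul_sum,
    ← sum_sub_distrib]
  refine smul_eq_zero_of_right _ (sum_eq_zero fun x _ => ?_)
  rw [sub_mul, mul_sub, sub_sub_sub_comm, numberOp, numberOp, number_pair_commutator,
    number_pair_commutator,
    if_neg (show orb x 0 ≠ orb z 1 from fun h => absurd (orb_eq_orb_iff.1 h).2 (by decide)),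
    if_neg (show orb x 1 ≠ orb z 0 from fun h => absurd (orb_eq_orb_iff.1 h).2 (by decide)),
    add_zero, zero_add]
  by_cases hx : x = z
  · subst hx
    rw [if_pos rfl, if_pos rfl, sub_self]
  · rw [if_neg (show orb x 0 ≠ orb z 0 from fun h => hx (orb_eq_orb_iff.1 h).1),
      if_neg (show orb x 1 ≠ orb z 1 from fun h => hx (orb_eq_orb_iff.1 h).1), sub_self]

/-- `[η†_ε, S⁺] = 0` for every sign `ε`. Yang–Zhang (1990), Theorem 2; Essler et al. (2005)
§2.2.5, eq. (2.85). [cite: YangZhang1990, Theorem 2] -/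
theorem etaRaise_commute_spinPlus (ε : Λ → ℤˣ) :
    Commute (etaRaise ε) (spinPlus : Matrix (Finset (Orb Λ)) (Finset (Orb Λ)) ℂ) := by
  have h := commutator_etaRaise ε spinPlus
  simp only [spinPlus_commutator_pairCreation, smul_zero, sum_const_zero] at h
  exact (sub_eq_zero.1 h).symm

/-- `[η†_ε, S^z] = 0` for every sign `ε`. Yang–Zhang (1990), Theorem 2; Essler et al. (2005)
§2.2.5, eq. (2.85). [cite: YangZhang1990, Theorem 2] -/
theorem etaRaise_commute_spinZ (ε : Λ → ℤˣ) :
    Commute (etaRaise ε) (spinZ : Matrix (Finset (Orb Λ)) (Finset (Orb Λ)) ℂ) := by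
  have h := commutator_etaRaise ε spinZ
  simp only [spinZ_commutator_pairCreation, smul_zero, sum_const_zero] at h
  exact (sub_eq_zero.1 h).symm

/-- **Discharge of `etaRaise_commute_spin`** (`SO(4)` symmetry: the `η`-pairing pseudospin
commutes with the spin): `[η†_ε, S⁺] = 0` and `[η†_ε, S^z] = 0` for every sign `ε : Λ → ℤˣ` on
every finite `Λ`. Yang–Zhang, Mod. Phys. Lett. B 4 (1990) 759, Theorem 2 ("all 3 components of
`J` commute with all 3 components of `J'`"); Essler et al. (2005) §2.2.5, eq. (2.85)
`[S^α, η^β] = 0`. [cite: YangZhang1990, Theorem 2] -/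
theorem etaRaise_commute_spin_holds : etaRaise_commute_spin (Λ := Λ) :=
  fun ε => ⟨etaRaise_commute_spinPlus ε, etaRaise_commute_spinZ ε⟩

end Hubbard

end Literature.MathematicalPhysics.QuantumLattice
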